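import Summits.RiemannHypothesis.RiemannHypothesis.Theorems.WeilColumnBSplineCDF
import HarnessLib

/-!
# The Irwin–Hall formula: the B-spline CDF is the alternating binomial sum of truncated powers (RH-FREE; W2 «IH bridge» of THETA-ASSIGN)

Cell `rh-explicit`, WEIL column, seat handoff-prove-2 gen12.  For `c > 0`, `k : ℕ`, `v : ℝ`:

  **`bsplineCDF c k v = irwinHall (k+1) ((v + (k+1)c)/(2c))`**, `irwinHall n s = (n!)⁻¹ Σ_{j=0}^{n} (−1)^j C(n,j) (max (s−j) 0)^n`

(`bsplineCDF_eq_irwinHall`): the CDF of `U₁ + ⋯ + U_{k+1}` (`Uᵢ` uniform on `[−c, c]`) is the Irwin–Hall CDF of the sum of `k+1`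
uniforms on `[0,1]` at the rescaled point.  Induction on `k`: base = the clamp; step: the density recursion
`re ρ_{k+1}(t) = (F_k(t+c) − F_k(t−c))/(2c)` (`bsplineDensity_succ_re_eq`), Pascal's rule on the alternating sum, and «same
derivative + same far-left value ⇒ equal».  This is the bridge that lets the arithmetic layer (cc-s2-1's exact `IH`/`Rtop`)
evaluate `P.cut` and `P.Rtop` (sequel `WeilColumnBSplineIrwinHallBridge`).  Nothing here bears on the truth of RH.
-/

noncomputable section

set_option linter.dupNamespace false

open Complex Set MeasureTheory Filter Finset
open scoped Real Topology

namespace Summit.RiemannHypothesis.RiemannHypothesis.Theorems.WeilColumn.ThetaMellin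

open Literature.NumberTheory.LFunctions ThetaParams

/-- The Irwin–Hall CDF polynomial with truncated powers: `(n!)⁻¹ Σ_{j=0}^{n} (−1)^j C(n,j) (max (s−j) 0)^n`. [folklore: Irwin–Hall] -/
def irwinHall (n : ℕ) (s : ℝ) : ℝ :=
  ((n.factorial : ℝ))⁻¹ * ∑ j ∈ Finset.range (n + 1), (-1 : ℝ) ^ j * (n.choose j : ℝ) * (max (s - j) 0) ^ n

variable {c : ℝ}

/-! ## §1 Truncated powers -/

/-- `d/dy (max y 0)^{n+1} = (n+1)(max y 0)^n` for `n ≥ 1` (the truncated power is `C¹` from exponent `2` on). [folklore] -/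
theorem hasDerivAt_max_pow {n : ℕ} (hn : 1 ≤ n) (x : ℝ) :
    HasDerivAt (fun y : ℝ ↦ (max y 0) ^ (n + 1)) (((n : ℝ) + 1) * (max x 0) ^ n) x := by
  rcases lt_trichotomy x 0 with hx | hx | hx
  · have hev : (fun y : ℝ ↦ (max y 0) ^ (n + 1)) =ᶠ[𝓝 x] fun _ ↦ (0 : ℝ) := by
      filter_upwards [Iio_mem_nhds hx] with y hy
      rw [max_eq_right (le_of_lt hy), zero_pow (by omega)]
    rw [max_eq_right hx.le, zero_pow (by omega), mul_zero]
    exact (hasDerivAt_const x (0 : ℝ)).congr_of_eventuallyEq hev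
  · subst hx
    rw [max_self, zero_pow (by omega), mul_zero, hasDerivAt_iff_isLittleO_nhds_zero]
    simp only [zero_add, max_self, zero_pow (show n + 1 ≠ 0 by omega), sub_zero, smul_zero]
    rw [Asymptotics.isLittleO_iff]
    intro ε hε
    filter_upwards [Metric.ball_mem_nhds (0 : ℝ) (lt_min one_pos hε)] with y hy
    rw [Metric.mem_ball, dist_zero_right, Real.norm_eq_abs, lt_min_iff] at hy
    rw [Real.norm_eq_abs, Real.norm_eq_abs, abs_of_nonneg (pow_nonneg (le_max_right _ _) _)]
    have h0 : 0 ≤ max y 0 := le_max_right _ _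
    have h1 : max y 0 ≤ |y| := max_le (le_abs_self y) (abs_nonneg y)
    have hyn : |y| ^ n ≤ ε := by
      calc |y| ^ n ≤ |y| ^ 1 := pow_le_pow_of_le_one (abs_nonneg _) hy.1.le hn
        _ ≤ ε := by rw [pow_one]; exact hy.2.le
    calc (max y 0) ^ (n + 1) = (max y 0) ^ n * max y 0 := pow_succ _ _
      _ ≤ |y| ^ n * |y| := mul_le_mul (pow_le_pow_left₀ h0 h1 n) h1 h0 (pow_nonneg (abs_nonneg _) _)
      _ ≤ ε * |y| := mul_le_mul_of_nonneg_right hyn (abs_nonneg y)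
  · have hev : (fun y : ℝ ↦ (max y 0) ^ (n + 1)) =ᶠ[𝓝 x] fun y ↦ y ^ (n + 1) := by
      filter_upwards [Ioi_mem_nhds hx] with y hy
      rw [max_eq_left (le_of_lt hy)]
    rw [max_eq_left hx.le]
    have h := (hasDerivAt_pow (n + 1) x).congr_of_eventuallyEq hev
    refine h.congr_deriv ?_
    push_cast
    simp

/-- The truncated power of an affine argument: `d/dv (max ((v+K)/(2c) − j) 0)^{n+1} = (n+1)(max … 0)^n/(2c)`. -/
theorem hasDerivAt_max_pow_affine {n : ℕ} (hn : 1 ≤ n) (d K j v : ℝ) :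
    HasDerivAt (fun v : ℝ ↦ (max ((v + K) / (2 * d) - j) 0) ^ (n + 1))
      (((n : ℝ) + 1) * (max ((v + K) / (2 * d) - j) 0) ^ n * (1 / (2 * d))) v := by
  have hlin : HasDerivAt (fun v : ℝ ↦ (v + K) / (2 * d) - j) (1 / (2 * d)) v := by
    have := (((hasDerivAt_id v).add_const K).div_const (2 * d)).sub_const j
    simpa using this
  exact (hasDerivAt_max_pow hn ((v + K) / (2 * d) - j)).comp v hlin

/-! ## §2 Pascal's rule on the alternating binomial sum -/

/-- `Σ_{j≤n+1} (−1)^j C(n+1,j) x_j = Σ_{j≤n} (−1)^j C(n,j) x_j − Σ_{j≤n} (−1)^j C(n,j) x_{j+1}`. [folklore] -/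
theorem alt_choose_sum_succ (n : ℕ) (x : ℕ → ℝ) :
    ∑ j ∈ Finset.range (n + 2), (-1 : ℝ) ^ j * ((n + 1).choose j : ℝ) * x j =
      ∑ j ∈ Finset.range (n + 1), (-1 : ℝ) ^ j * (n.choose j : ℝ) * x j -
        ∑ j ∈ Finset.range (n + 1), (-1 : ℝ) ^ j * (n.choose j : ℝ) * x (j + 1) := by
  -- extend the first sum on the right to `range (n+2)` (the extra term has `C(n, n+1) = 0`)
  have hext : ∑ j ∈ Finset.range (n + 1), (-1 : ℝ) ^ j * (n.choose j : ℝ) * x j =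
      ∑ j ∈ Finset.range (n + 2), (-1 : ℝ) ^ j * (n.choose j : ℝ) * x j := by
    rw [Finset.sum_range_succ _ (n + 1), Nat.choose_succ_self]; simp
  rw [hext, Finset.sum_range_succ' _ (n + 1), Finset.sum_range_succ' (fun j ↦ (-1 : ℝ) ^ j * (n.choose j : ℝ) * x j) (n + 1)]
  simp only [Nat.choose_zero_right, pow_zero, Nat.cast_one, one_mul]
  have hpas : ∀ j ∈ Finset.range (n + 1), (-1 : ℝ) ^ (j + 1) * ((n + 1).choose (j + 1) : ℝ) * x (j + 1) =
      (-1 : ℝ) ^ (j + 1) * (n.choose (j + 1) : ℝ) * x (j + 1) - (-1 : ℝ) ^ j * (n.choose j : ℝ) * x (j + 1) := by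
    intro j _
    rw [Nat.choose_succ_succ', Nat.cast_add, pow_succ]
    ring
  rw [Finset.sum_congr rfl hpas, Finset.sum_sub_distrib]
  ring

/-- `irwinHall n s = 0` for `s ≤ 0`, `n ≥ 1`. -/
theorem irwinHall_of_nonpos {n : ℕ} (hn : 1 ≤ n) {s : ℝ} (hs : s ≤ 0) : irwinHall n s = 0 := by
  unfold irwinHall
  rw [Finset.sum_eq_zero fun j _ ↦ ?_, mul_zero]
  rw [max_eq_right (by linarith [(Nat.cast_nonneg j : (0 : ℝ) ≤ j)]), zero_pow (by omega), mul_zero]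

/-! ## §3 The base case: one uniform density -/

/-- `bsplineCDF c 0 v = irwinHall 1 ((v+c)/(2c))` (the clamp). [folklore] -/
theorem bsplineCDF_zero_eq (hc : 0 < c) (v : ℝ) : bsplineCDF c 0 v = irwinHall 1 ((v + c) / (2 * c)) := by
  have hIH : irwinHall 1 ((v + c) / (2 * c)) = max ((v + c) / (2 * c)) 0 - max ((v + c) / (2 * c) - 1) 0 := by
    unfold irwinHall
    simp [Finset.sum_range_succ]
    ring
  rw [hIH]
  rcases le_or_gt v (-c) with h1 | h1
  · rw [bsplineCDF_eq_zero hc.le 0 (by simpa using h1)]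
    have hs : (v + c) / (2 * c) ≤ 0 := div_nonpos_of_nonpos_of_nonneg (by linarith) (by linarith)
    rw [max_eq_right hs, max_eq_right (by linarith)]; ring
  rcases le_or_gt c v with h2 | h2
  · rw [bsplineCDF_eq_one hc 0 (by simpa using h2)]
    have hs : 1 ≤ (v + c) / (2 * c) := by rw [le_div_iff₀ (by linarith)]; linarith
    rw [max_eq_left (by linarith), max_eq_left (by linarith)]; ring
  -- the middle: `−c < v < c`
  have hs0 : 0 ≤ (v + c) / (2 * c) := div_nonneg (by linarith) (by linarith)
  have hs1 : (v + c) / (2 * c) - 1 ≤ 0 := by rw [sub_nonpos, div_le_one (by linarith)]; linarith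
  rw [max_eq_left hs0, max_eq_right hs1, sub_zero]
  unfold bsplineCDF
  have hre : (fun t ↦ (bsplineDensity c 0 t).re) = (Icc (-c) c).indicator fun _ ↦ (2 * c)⁻¹ := by
    funext t
    rw [show bsplineDensity c 0 = unifDensity c from rfl, unifDensity_apply, Set.indicator_apply]
    split_ifs <;> simp
  rw [hre, setIntegral_indicator measurableSet_Icc, setIntegral_const,
    show Iic v ∩ Icc (-c) c = Icc (-c) v from by
      ext t; simp only [Set.mem_inter_iff, Set.mem_Iic, Set.mem_Icc]; constructor
      · rintro ⟨h, h', -⟩; exact ⟨h', h⟩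
      · rintro ⟨h, h'⟩; exact ⟨h', h, by linarith⟩,
    Real.volume_real_Icc_of_le (by linarith), smul_eq_mul]
  field_simp
  ring

/-! ## §4 The density recursion `re ρ_{k+1}(t) = (F_k(t+c) − F_k(t−c))/(2c)` -/

/-- **Density recursion in CDF form**: `re(bsplineDensity c (k+1) t) = (bsplineCDF c k (t+c) − bsplineCDF c k (t−c))/(2c)` (`c > 0`). -/
theorem bsplineDensity_succ_re_eq (hc : 0 < c) (k : ℕ) (t : ℝ) :
    (bsplineDensity c (k + 1) t).re = (bsplineCDF c k (t + c) - bsplineCDF c k (t - c)) / (2 * c) := by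
  rw [bsplineDensity_succ_re]
  have hint := integrable_bsplineDensity_re c k
  have hfun : (fun u ↦ (unifDensity c u).re * (bsplineDensity c k (t - u)).re) =
      (Icc (-c) c).indicator fun u ↦ (2 * c)⁻¹ * (bsplineDensity c k (t - u)).re := by
    funext u
    rw [unifDensity_apply, Set.indicator_apply]
    split_ifs <;> simp
  rw [hfun, integral_indicator measurableSet_Icc, integral_const_mul, integral_Icc_eq_integral_Ioc,
    ← intervalIntegral.integral_of_le (by linarith : -c ≤ c),
    intervalIntegral.integral_comp_sub_left (fun w ↦ (bsplineDensity c k w).re) t, sub_neg_eq_add,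
    ← intervalIntegral.integral_Iic_sub_Iic hint.integrableOn hint.integrableOn]
  unfold bsplineCDF
  field_simp

/-! ## §5 The derivative of the Irwin–Hall polynomial along `v ↦ (v + (k+2)c)/(2c)` -/

/-- `d/dv irwinHall (k+2) ((v+(k+2)c)/(2c)) = ((k+1)!)⁻¹ Σ_{j≤k+2} (−1)^j C(k+2,j) (max (s−j) 0)^{k+1} / (2c)`, `s = (v+(k+2)c)/(2c)`. -/
theorem hasDerivAt_irwinHall_comp (hc : 0 < c) (k : ℕ) (v : ℝ) :
    HasDerivAt (fun v : ℝ ↦ irwinHall (k + 2) ((v + ((k : ℝ) + 2) * c) / (2 * c)))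
      ((((k + 1).factorial : ℝ))⁻¹ *
        (∑ j ∈ Finset.range (k + 3), (-1 : ℝ) ^ j * ((k + 2).choose j : ℝ) *
          (max ((v + ((k : ℝ) + 2) * c) / (2 * c) - j) 0) ^ (k + 1)) * (1 / (2 * c))) v := by
  unfold irwinHall
  have hterm : ∀ j ∈ Finset.range (k + 2 + 1), HasDerivAt
      (fun v : ℝ ↦ (-1 : ℝ) ^ j * ((k + 2).choose j : ℝ) * (max ((v + ((k : ℝ) + 2) * c) / (2 * c) - j) 0) ^ (k + 2))
      ((-1 : ℝ) ^ j * ((k + 2).choose j : ℝ) *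
        ((((k + 1 : ℕ) : ℝ) + 1) * (max ((v + ((k : ℝ) + 2) * c) / (2 * c) - j) 0) ^ (k + 1) * (1 / (2 * c)))) v := by
    intro j _
    exact (hasDerivAt_max_pow_affine (n := k + 1) (by omega) c (((k : ℝ) + 2) * c) j v).const_mul _
  have hsum := (HasDerivAt.fun_sum hterm).const_mul (((k + 2).factorial : ℝ))⁻¹
  refine hsum.congr_deriv ?_
  rw [show k + 2 + 1 = k + 3 by ring, Finset.mul_sum, Finset.mul_sum, Finset.sum_mul]
  refine Finset.sum_congr rfl fun j _ ↦ ?_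
  have hf : (((k + 2).factorial : ℝ)) = ((k : ℝ) + 2) * ((k + 1).factorial : ℝ) := by
    rw [Nat.factorial_succ]; push_cast; ring
  rw [hf]
  have h1 : ((k + 1).factorial : ℝ) ≠ 0 := by positivity
  have h2 : (k : ℝ) + 2 ≠ 0 := by positivity
  push_cast
  field_simp
  ring

/-! ## §6 THE IRWIN–HALL FORMULA -/

/-- **`bsplineCDF c k v = irwinHall (k+1) ((v + (k+1)c)/(2c))`** for `c > 0`. [folklore: Irwin–Hall] -/
theorem bsplineCDF_eq_irwinHall (hc : 0 < c) : ∀ (k : ℕ) (v : ℝ),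
    bsplineCDF c k v = irwinHall (k + 1) ((v + ((k : ℝ) + 1) * c) / (2 * c))
  | 0, v => by simpa using bsplineCDF_zero_eq hc v
  | k + 1, v => by
      -- the candidate and its derivative
      set Ψ : ℝ → ℝ := fun v ↦ irwinHall (k + 2) ((v + ((k : ℝ) + 2) * c) / (2 * c)) with hΨ
      have hIH : ∀ w, bsplineCDF c k w = irwinHall (k + 1) ((w + ((k : ℝ) + 1) * c) / (2 * c)) :=
        fun w ↦ bsplineCDF_eq_irwinHall hc k w
      have hΨ' : ∀ w, HasDerivAt Ψ ((bsplineDensity c (k + 1) w).re) w := by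
        intro w
        have h := hasDerivAt_irwinHall_comp hc k w
        rw [bsplineDensity_succ_re_eq hc k w, hIH (w + c), hIH (w - c)]
        refine h.congr_deriv ?_
        set s : ℝ := (w + ((k : ℝ) + 2) * c) / (2 * c) with hs
        have e1 : (w + c + ((k : ℝ) + 1) * c) / (2 * c) = s := by rw [hs]; ring
        have e2 : (w - c + ((k : ℝ) + 1) * c) / (2 * c) = s - 1 := by rw [hs]; field_simp; ring
        rw [e1, e2, alt_choose_sum_succ (k + 1) (fun j ↦ (max (s - j) 0) ^ (k + 1))]
        unfold irwinHall
        have ej : ∀ j : ℕ, (max (s - ((j + 1 : ℕ) : ℝ)) 0) ^ (k + 1) = (max (s - 1 - (j : ℝ)) 0) ^ (k + 1) := by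
          intro j; push_cast; ring_nf
        simp only [ej]
        field_simp
      have hF' : ∀ w, HasDerivAt (bsplineCDF c (k + 1)) ((bsplineDensity c (k + 1) w).re) w :=
        fun w ↦ hasDerivAt_bsplineCDF hc (by omega) w
      -- the difference is constant
      have hdiff : Differentiable ℝ fun w ↦ bsplineCDF c (k + 1) w - Ψ w :=
        fun w ↦ ((hF' w).fun_sub (hΨ' w)).differentiableAt
      have hderiv0 : ∀ w, deriv (fun w ↦ bsplineCDF c (k + 1) w - Ψ w) w = 0 := by
        intro w; rw [((hF' w).fun_sub (hΨ' w)).deriv, sub_self]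
      set v₀ : ℝ := -(((k : ℝ) + 2) * c) - 1 with hv₀
      have hconst := is_const_of_deriv_eq_zero hdiff hderiv0 v v₀
      have hF0 : bsplineCDF c (k + 1) v₀ = 0 := bsplineCDF_eq_zero hc.le (k + 1) (by rw [hv₀]; push_cast; nlinarith)
      have hΨ0 : Ψ v₀ = 0 := by
        simp only [hΨ]
        refine irwinHall_of_nonpos (by omega) ?_
        rw [hv₀, show -(((k : ℝ) + 2) * c) - 1 + ((k : ℝ) + 2) * c = -1 by ring]
        exact div_nonpos_of_nonpos_of_nonneg (by norm_num) (by linarith)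
      simp only [hF0, hΨ0, sub_self] at hconst
      have : bsplineCDF c (k + 1) v = Ψ v := by linarith
      rw [this, hΨ]
      push_cast
      ring_nf

end Summit.RiemannHypothesis.RiemannHypothesis.Theorems.WeilColumn.ThetaMellin

end
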